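/-
Copyright (c) 2026 the pub-hodgecm-mathlib formalisation cell (harness21).  Prover seat hodgecm-mathlib-R90-C10-p01 (g4), R90-TF SLAB section S1 «Ch10-local» (base
R90-C10), h413 = `stmt-HodgeConjecture-24833`; U4 :182 wild socket (S-W), BRICK 1 (W-0) (S1 dealer R90-C10-plan (g3), R-S1-36 (1), 2026-09-05T03:16:01Z; census
R90-C10-p02 (g3) `CENSUS-SW-firstbrick.v1.md` f6499a1ef9af7a8e §6): «A MINIMAL TRACE-ONE ELEMENT EXISTS» — place-uniform infrastructure for every wild road.  2026-09-05.
-/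
import Summits.HodgeConjecture.HodgeConjecture.Theorems.K2E3LocalTraceOneLetter                 -- ★ p862457 (K2E3-p37 (g2)): `valued_two_eq_one_of_ramified_of_traceOne` (SCOPE §3), `exists_traceOne_local_of_…` (sources §2); brings ★ `galAdicCompletionMap_galAdicCompletionMap_of_smul_eq` (`σ_w σ_w = 1`), ★ `conjLocal_apply_eq_of_smul_eq`, ★ `PlacesOver.eq_of_smul_eq`, ★ `valued_galAdicCompletionMap`
import Literature.NumberTheory.Automorphic.SatakeW0SymmetryAdicCompletion                        -- ★ `UnitaryGroup.exists_galAdicCompletionMap_ne` (`σ_w ≠ id`)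
import Literature.NumberTheory.Automorphic.Liu2021.LemD1AsPrintedIndexedNonVacuityTameSynthesis  -- ★ `isUnramifiedIn_of_ramificationIdx'_eq_one` (`e(w∣v) = 1 ⟹ v` unramified, at a non-split `v`)
import HarnessLib

/-!
# R90-TF · S1 (Rogawski 1990 Ch. 12, local) — (W-0) `R90S1WildTraceOneMinimal`: a MINIMAL trace-one element of `L_w ∕ L⁺_v` exists at every non-split place — the `htmin` letter of ★ (O1)

Cell hodgecm-mathlib, slab R90-TF (director brief v2), section S1 «Ch10-local» (base R90-C10), crux h413 = stmt-HodgeConjecture-24833 (lane `--supports … --as helper`),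
route `route-HodgeConjecture-HCCMUnconditional` (no route verbs).  U4 :182, wild socket (S-W) `sig_K2E3KeysThmTwoContractingRamifiedCharOnePosDepthWild` (organ
`K2_E3_EllipticInputsSigs_U4Keys` ED. 11 :266): BRICK 1 (W-0) of the S1 dealer R90-C10-plan (g3) (R-S1-36 (1), 2026-09-05T03:16:01Z) on R90-C10-p02 (g3)'s first-brick
census `R90/R90-C10-p02/g3/CENSUS-SW-firstbrick.v1.md` f6499a1ef9af7a8e §6.  THEOREMS ONLY (no `def`, no `instance`, no notation, no named fact, no `sorry`); ★-only imports.

THE POINT.  Every two-depth ∕ shell ∕ Road-I-base-case brick at a WILDLY RAMIFIED dyadic place needs a trace-one element `t` (`t + σ_w t = 1`) of `E = L_w` over `F = L⁺_v`;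
there is NO integral one there (`Tr(𝒪_E) = 𝔭_F^{⌊d∕2⌋} ∌ 1`, `d ≥ 2` the different exponent — ★ p862457 §3 `valued_two_eq_one_of_ramified_of_traceOne`), and the uniform
replacement letter is MINIMALITY: ★ (O1) `K2E3ConcaveLevelIwahoriCharacterMin` (K2E3-p34 (g3)) runs the two-depth character identity under
`(ht : t + σ t = 1) (htmin : ∀ a : K, a + σ a = 1 → Valued.v t ≤ Valued.v a)` (its :122, model frame `{K} [Field K] [Valued K ℤᵐ⁰] (σ : K →+* K)`), a letter NO file in
the tree discharges (census §6: `rg traceMin|htmin` → (O1) only).  THIS FILE DISCHARGES IT, place-uniformly: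
* §1 MODEL level (★ (O1)'s frame VERBATIM): `one_le_valued_of_traceOne` («a trace-one element is never topologically nilpotent»: `a + σa = 1 ⟹ 1 ≤ |a|`, needs `|σ·| = |·|`);
  `div_sub_add_map_div_sub_eq_one` (the witness `e ∕ (e − σe)` has trace one whenever `σe ≠ e`, needs `σσ = 1`); **`exists_traceOne_min (hσ : ∀ a, σ (σ a) = a)
  (hvσ : ∀ a, Valued.v (σ a) = Valued.v a) (hne : ∃ e, σ e ≠ e) : ∃ t : K, t + σ t = 1 ∧ ∀ a : K, a + σ a = 1 → Valued.v t ≤ Valued.v a`** — the conclusion is (O1)'s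
  `ht`∕`htmin` binder pair TOKEN FOR TOKEN, so `obtain ⟨t, ht, htmin⟩ := exists_traceOne_min σ hσ hvσ hne` feeds ★ `chi_mk0_one_add_eq_one_of_traceMin` ∕
  `chi_apply_zero_zero_mul_of_concave_min` with NO rewriting (proof: the valuations of trace-one elements are `exp n`, `n ∈ ℕ` by §1's bound; `Nat.find`);
  `valued_eq_valued_of_traceMin` (the minimal value is unique); `valued_traceMin_le_one_iff` (the minimal `t` is integral iff SOME trace-one element is).
* §2 ADIC level at a place `w ∣ v` fixed by `c` (`σ_w := galAdicCompletionMap c hw`, ★ `σ_w σ_w = 1`, ★ `|σ_w ·| = |·|`, ★ `σ_w ≠ id`): **`exists_traceOne_min_adic`**;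
  **`one_lt_valued_of_traceOne_of_ramified_dyadic`** — at a RAMIFIED `w` with `|2|_w ≠ 1` EVERY trace-one element has `|a| > 1` (contrapositive of ★ p862457 §3), so the
  minimal `t` of §2 has `1 < |t|` there (`one_lt_valued_traceMin_of_wild`, stated with the (S-W) socket's selectors `¬ IsUnramifiedIn` ∕ `|2|_w ≠ 1` via ★
  `isUnramifiedIn_of_ramificationIdx'_eq_one`); `valued_traceMin_le_one_of_…` — at an unramified `v`, or when `|2|_w = 1`, the minimal `t` IS integral (★ p862457 §2 sources).
* §3 the PLACE-FREE `LocalRing L v = Π_{w ∣ v} L_w` form at a non-split `v` (the spelling a frame-free socket carries, ★ p862457 §1 transport):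
  **`exists_traceOne_min_local`** `: ∃ t : LocalRing L v, t + conjLocal L c v t = 1 ∧ ∀ a, a + conjLocal L c v a = 1 → ∀ w′, Valued.v (t w′) ≤ Valued.v (a w′)`.
CONSUMERS (census §6, dealer R-S1-36): the determinant road's wild volumes ((W-1) `R90S1WildHeisenbergFibre`, p02 (g3): `dist(a, E⁻) = |Tr a|·|t_min|`), Road I's base case
(K2E3-p34 (O2) `(J(w₀,χ)f_e)(1) = vol(N̄ ∩ J_e)·f_e(1)`), and ★ (O1) itself.  [Serre1979 III §3: `Tr(𝔭_E^j) = 𝔭_F^{⌊(j+d)∕2⌋}`, so `|t_min| = |ϖ_w|^{−(d−1)}`; Tits 1979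
§1.15: the same defect is the Bruhat–Tits invariant of wild quasi-split `SU₃` — neither closed form is needed or asserted here.]

HONEST LABEL.  HC_CM is proved only modulo the 7 printed citations (2 remaining named inputs: hLiu418 = stmt-HodgeConjecture-24832, h413 = stmt-HodgeConjecture-24833) until
rung 0 closes; count-neutral INFRASTRUCTURE — pays NO socket; (S-W) stays the XL residual of :182 (census §7: irreducibility at a wild `w` = Road I ∕ unprinted Road III);
:182 REL over {(S-RT), (S-W)}; C :88∕:98 ∕ A2′ OPEN; REL ≠ ★ ≠ BUILT.

## References
* [Serre1979] J.-P. Serre, *Local Fields*, GTM 67 (1979), Ch. III §3 Prop. 7 (trace and different: `Tr(𝔭_E^j) = 𝔭_F^{⌊(j+d)∕2⌋}`), Ch. IV §1 Prop. 4, Ch. V §3.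
* [Tits1979] J. Tits, *Reductive groups over local fields*, Proc. Sympos. Pure Math. 33 Part 1 (1979), §1.15 (wild quasi-split `SU₃`: the valuation of the root-group
  datum `(u, v)`, `v + v̄ = uū`, and the element of maximal valuation with trace one).
* [BruhatTits1972] F. Bruhat, J. Tits, *Groupes réductifs sur un corps local I*, Publ. Math. IHÉS 41 (1972), (6.4.9), §10.
* [Rogawski1990] J. D. Rogawski, *Automorphic Representations of Unitary Groups in Three Variables*, Ann. of Math. Stud. 123 (1990), §12.2 (1)–(3) p. 173 (Keys'
  reducibility list; the socket (S-W) is its wild dyadic corner), §4.5 p. 45.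
* [Keys1984] D. Keys, *Principal series representations of special unitary groups over local fields*, Compositio Math. 51 (1984), §5 Remark p. 125 (`char 𝓀 = 2`), §7 Thm. (2) p. 126.
* [CasselsFrohlichANT1967] J. W. S. Cassels, A. Fröhlich (eds.), *Algebraic Number Theory* (1967), Ch. II §10–§11 (`L ⊗_K K_v = Π_w L_w`), Ch. VII §1.1.
-/

set_option autoImplicit false
-- the mandated namespace has the single-problem summit's repeated segment (`HodgeConjecture.HodgeConjecture`)
set_option linter.dupNamespace false

noncomputable section

open NumberField IsDedekindDomain
open scoped WithZero Valued
open Literature.NumberTheory Literature.NumberTheory.Automorphic Literature.NumberTheory.Automorphic.UnitaryGroup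
open Summit.HodgeConjecture.HodgeConjecture.Cruxes.H413
open Literature.NumberTheory.Automorphic.Liu2021.LemD1IndexedNonVacuityTameSynthesis (isUnramifiedIn_of_ramificationIdx'_eq_one)

namespace Summit.HodgeConjecture.HodgeConjecture.R90.S1

/-! ## §0 ALGEBRA — trace-one elements for an involution `σ` of a field (no valuation) -/

section Algebra

variable {K : Type*} [Field K] (σ : K →+* K) (hσ : ∀ a, σ (σ a) = a)

/-- **A trace-one element is non-zero** (`0 + σ0 = 0 ≠ 1`). [cite: Serre1979, Ch. III §3] -/
theorem traceOne_ne_zero {a : K} (ha : a + σ a = 1) : a ≠ 0 := by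
  rintro rfl
  rw [map_zero, add_zero] at ha
  exact zero_ne_one ha

include hσ in
/-- **THE WITNESS: `e ∕ (e − σe)` has trace one whenever `σe ≠ e`** (`σ` an involution: `σ(e∕(e − σe)) = σe∕(σe − e)`, and `e∕(e − σe) − σe∕(e − σe) = 1`).  At a
wildly ramified dyadic place this is how a (non-integral) trace-one element is produced with no `2⁻¹` and no unramified unit (★ p862372 §3's `a∕(a − σa)`, freed of
its integrality clause). [cite: Serre1979, Ch. III §3] [cite: Tits1979, §1.15] -/
theorem div_sub_add_map_div_sub_eq_one {e : K} (he : σ e ≠ e) : e / (e - σ e) + σ (e / (e - σ e)) = 1 := by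
  have hd : e - σ e ≠ 0 := sub_ne_zero.2 (Ne.symm he)
  rw [map_div₀, map_sub, hσ, show σ e - e = -(e - σ e) by ring, div_neg, ← sub_eq_add_neg, ← sub_div, div_self hd]

include hσ in
/-- A trace-one element exists as soon as `σ ≠ id` (the witness above; no valuation). [cite: Serre1979, Ch. III §3] -/
theorem exists_traceOne_of_exists_ne (hne : ∃ e, σ e ≠ e) : ∃ t : K, t + σ t = 1 := by
  obtain ⟨e, he⟩ := hne
  exact ⟨e / (e - σ e), div_sub_add_map_div_sub_eq_one σ hσ he⟩

end Algebra

/-! ## §1 MODEL level — ★ (O1)'s frame `{K} [Field K] [Valued K ℤᵐ⁰] (σ : K →+* K)` verbatim -/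

section Model

variable {K : Type*} [Field K] [Valued K ℤᵐ⁰] (σ : K →+* K)
  (hσ : ∀ a, σ (σ a) = a) (hvσ : ∀ a, Valued.v (σ a) = Valued.v a)

include hvσ in
/-- **A trace-one element is never topologically nilpotent: `a + σa = 1 ⟹ 1 ≤ |a|`** (else `|a + σa| ≤ max(|a|, |σa|) < 1 = |1|`; `|σ·| = |·|`).  The lower bound
that makes a MINIMAL trace-one element exist (§1 `exists_traceOne_min`), and the reason every INTEGRAL one is minimal (★ (O1) `traceMin_of_v_le_one`).
[cite: Serre1979, Ch. III §3 Prop. 7] -/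
theorem one_le_valued_of_traceOne {a : K} (ha : a + σ a = 1) : 1 ≤ Valued.v a := by
  refine not_lt.1 fun hlt => ?_
  have h1 : Valued.v (a + σ a) < 1 := lt_of_le_of_lt (Valued.v.map_add_le le_rfl (by rw [hvσ])) hlt
  rw [ha, Valuation.map_one] at h1
  exact lt_irrefl _ h1

include hσ hvσ in
/-- **(W-0) A MINIMAL TRACE-ONE ELEMENT EXISTS — the `ht`∕`htmin` letter pair of ★ (O1) `K2E3ConcaveLevelIwahoriCharacterMin` (:122) DISCHARGED, token for token.**
For an isometric involution `σ` of a discretely valued field `K` (`σσ = 1`, `|σ·| = |·|`) moving some element (`σ ≠ id`): **there is `t ∈ K` with `t + σt = 1` and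
`|t| ≤ |a|` for EVERY `a` with `a + σa = 1`.**  Proof: trace-one elements exist (`e∕(e − σe)`, §0) and have valuations `1 ≤ |a| = exp(n)`, `n ∈ ℕ` (§1); take one of least
`n` (`Nat.find`).  (Value: `|t| = 1` off the wildly ramified dyadic places, `|t| = |ϖ_w|^{−(d−1)} > 1` at them — §2; neither closed form is asserted here.)
USE: `obtain ⟨t, ht, htmin⟩ := exists_traceOne_min σ hσ hvσ hne` then ★ (O1) `chi_mk0_one_add_eq_one_of_traceMin … ht htmin …` with no rewriting.
[cite: Serre1979, Ch. III §3 Prop. 7] [cite: Tits1979, §1.15] [cite: BruhatTits1972, (6.4.9)] -/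
theorem exists_traceOne_min (hne : ∃ e, σ e ≠ e) : ∃ t : K, t + σ t = 1 ∧ ∀ a : K, a + σ a = 1 → Valued.v t ≤ Valued.v a := by
  classical
  obtain ⟨e, he⟩ := hne
  -- every trace-one `a` has `|a| = exp (log |a|)` with `0 ≤ log |a|`
  have hlog : ∀ a : K, a + σ a = 1 → 0 ≤ WithZero.log (Valued.v a) ∧ WithZero.exp (WithZero.log (Valued.v a)) = Valued.v a := fun a ha => by
    have h0 : Valued.v a ≠ 0 := (Valuation.ne_zero_iff _).2 (traceOne_ne_zero σ ha)
    exact ⟨(WithZero.le_log_iff_exp_le h0).2 (by rw [WithZero.exp_zero]; exact one_le_valued_of_traceOne σ hvσ ha), WithZero.exp_log h0⟩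
  -- the set of `n : ℕ` realised as `log |a|` by a trace-one `a` is non-empty (the witness `e ∕ (e − σe)`)
  have hP : ∃ n : ℕ, ∃ a : K, a + σ a = 1 ∧ Valued.v a = WithZero.exp (n : ℤ) := by
    refine ⟨(WithZero.log (Valued.v (e / (e - σ e)))).toNat, e / (e - σ e), div_sub_add_map_div_sub_eq_one σ hσ he, ?_⟩
    obtain ⟨h0, hexp⟩ := hlog _ (div_sub_add_map_div_sub_eq_one σ hσ he)
    rw [Int.toNat_of_nonneg h0, hexp]
  -- a trace-one element of least `n`
  obtain ⟨t, ht, hvt⟩ := Nat.find_spec hP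
  refine ⟨t, ht, fun a ha => ?_⟩
  obtain ⟨h0, hexp⟩ := hlog a ha
  have hmin : Nat.find hP ≤ (WithZero.log (Valued.v a)).toNat :=
    Nat.find_min' hP ⟨a, ha, by rw [Int.toNat_of_nonneg h0, hexp]⟩
  rw [hvt, ← hexp, WithZero.exp_le_exp, ← Int.toNat_of_nonneg h0]
  exact_mod_cast hmin

/-- **The minimal value is unique**: two minimal trace-one elements have the same valuation. [cite: Serre1979, Ch. III §3 Prop. 7] -/
theorem valued_eq_valued_of_traceMin {t t' : K} (ht : t + σ t = 1) (htmin : ∀ a : K, a + σ a = 1 → Valued.v t ≤ Valued.v a)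
    (ht' : t' + σ t' = 1) (htmin' : ∀ a : K, a + σ a = 1 → Valued.v t' ≤ Valued.v a) : Valued.v t = Valued.v t' :=
  le_antisymm (htmin t' ht') (htmin' t ht)

/-- **The minimal trace-one element is integral iff SOME trace-one element is** (`1 ≤ |a|` always, §1).  So `|t_min| = 1` exactly when the integral trace-one letter of ★
p862457 (`t + σt = 1 ∧ |t| ≤ 1`) is available, and `|t_min| > 1` exactly at the places where it is not (§2: the wildly ramified dyadic ones). [cite: Serre1979, Ch. III §3 Prop. 7] -/
theorem valued_traceMin_le_one_iff {t : K} (ht : t + σ t = 1) (htmin : ∀ a : K, a + σ a = 1 → Valued.v t ≤ Valued.v a) :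
    Valued.v t ≤ 1 ↔ ∃ a : K, a + σ a = 1 ∧ Valued.v a ≤ 1 :=
  ⟨fun h => ⟨t, ht, h⟩, fun ⟨a, ha, hva⟩ => (htmin a ha).trans hva⟩

include hvσ in
/-- The minimal trace-one element has `|t| = 1` iff some trace-one element is integral (§1: `1 ≤ |t|` always). [cite: Serre1979, Ch. III §3 Prop. 7] -/
theorem valued_traceMin_eq_one_iff {t : K} (ht : t + σ t = 1) (htmin : ∀ a : K, a + σ a = 1 → Valued.v t ≤ Valued.v a) :
    Valued.v t = 1 ↔ ∃ a : K, a + σ a = 1 ∧ Valued.v a ≤ 1 := by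
  rw [← valued_traceMin_le_one_iff σ ht htmin]
  exact ⟨le_of_eq, fun h => le_antisymm h (one_le_valued_of_traceOne σ hvσ ht)⟩

end Model

/-! ## §2 ADIC level — the place `w ∣ v` fixed by complex conjugation, `σ_w := galAdicCompletionMap c hw` -/

section Adic

variable (L : Type) [Field L] [NumberField L] [IsCMField L] (v : HeightOneSpectrum (𝓞 ↥(maximalRealSubfield L)))
  (w : PlacesOver L v) (hw : IsCMField.complexConj L • w.1 = w.1)

/-- **(W-0) AT A PLACE: a minimal trace-one element of `L_w` over `L⁺_v` exists** at every place `w` fixed by complex conjugation (§1 `exists_traceOne_min` at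
`σ_w = galAdicCompletionMap c hw`: an involution ★ `galAdicCompletionMap_galAdicCompletionMap_of_smul_eq`, isometric ★ `valued_galAdicCompletionMap`, non-trivial ★
`exists_galAdicCompletionMap_ne`).  Conclusion in ★ (O1)'s `ht`∕`htmin` shape at `K := L_w`. [cite: Serre1979, Ch. III §3 Prop. 7] [cite: Tits1979, §1.15] -/
theorem exists_traceOne_min_adic :
    ∃ t : w.1.adicCompletion L, t + galAdicCompletionMap (L := L) (IsCMField.complexConj L) hw t = 1 ∧
      ∀ a : w.1.adicCompletion L, a + galAdicCompletionMap (L := L) (IsCMField.complexConj L) hw a = 1 → Valued.v t ≤ Valued.v a :=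
  exists_traceOne_min (galAdicCompletionMap (L := L) (IsCMField.complexConj L) hw)
    (galAdicCompletionMap_galAdicCompletionMap_of_smul_eq (IsCMField.complexConj L) w (IsCMField.complexConj_ne_one L) hw)
    (fun a => valued_galAdicCompletionMap (L := L) (IsCMField.complexConj L) hw a)
    (UnitaryGroup.exists_galAdicCompletionMap_ne (IsCMField.complexConj L) (IsCMField.complexConj_ne_one L) v w hw)

/-- **`1 ≤ |a|_w` for every trace-one `a ∈ L_w`** (§1 at `σ_w`). [cite: Serre1979, Ch. III §3 Prop. 7] -/
theorem one_le_valued_of_traceOne_adic {a : w.1.adicCompletion L}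
    (ha : a + galAdicCompletionMap (L := L) (IsCMField.complexConj L) hw a = 1) : 1 ≤ Valued.v a :=
  one_le_valued_of_traceOne (galAdicCompletionMap (L := L) (IsCMField.complexConj L) hw)
    (fun x => valued_galAdicCompletionMap (L := L) (IsCMField.complexConj L) hw x) ha

/-- **NO INTEGRAL TRACE-ONE ELEMENT AT A WILDLY RAMIFIED DYADIC PLACE: every trace-one `a ∈ L_w` has `|a|_w > 1`** when `w ∣ v` is RAMIFIED (`e(w∣v) ≠ 1`) and
`|2|_w ≠ 1` — the contrapositive of ★ p862457 §3 `valued_two_eq_one_of_ramified_of_traceOne` (an integral trace-one element at a ramified `w` forces `|2|_w = 1`).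
So there the minimal `t` of `exists_traceOne_min_adic` is NOT integral (`Tr(𝒪_E) = 𝔭_F^{⌊d∕2⌋}`, `d ≥ 2`). [cite: Serre1979, Ch. III §3 Prop. 7, Ch. IV §1 Prop. 4] [cite: Tits1979, §1.15] -/
theorem one_lt_valued_of_traceOne_of_ramified_dyadic (he : v.asIdeal.ramificationIdx' w.1.asIdeal ≠ 1)
    (h2 : Valued.v (2 : w.1.adicCompletion L) ≠ 1) {a : w.1.adicCompletion L}
    (ha : a + galAdicCompletionMap (L := L) (IsCMField.complexConj L) hw a = 1) : 1 < Valued.v a :=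
  lt_of_le_of_ne (one_le_valued_of_traceOne_adic L v w hw ha) fun h1 =>
    h2 (K2E3LocalTraceOneLetter.valued_two_eq_one_of_ramified_of_traceOne L v w hw he ha (le_of_eq h1.symm))

/-- **The (S-W) socket's selectors force `|t|_w > 1` for every trace-one `t`**: at a non-split `v` NOT unramified in `L` (★ `isUnramifiedIn_of_ramificationIdx'_eq_one`:
then `e(w∣v) ≠ 1` at the place `w` above `v`) with `|2|_w ≠ 1` — the organ's `hunr`∕`h2` tokens of `sig_K2E3KeysThmTwoContractingRamifiedCharOnePosDepthWild` read at `w`.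
[cite: Serre1979, Ch. III §3 Prop. 7, Ch. IV §1 Prop. 4] [cite: Rogawski1990, §12.2 p. 173] -/
theorem one_lt_valued_of_traceOne_of_not_isUnramifiedIn (hunr : ¬ Algebra.IsUnramifiedIn (𝓞 L) v.asIdeal)
    (h2 : Valued.v (2 : w.1.adicCompletion L) ≠ 1) {a : w.1.adicCompletion L}
    (ha : a + galAdicCompletionMap (L := L) (IsCMField.complexConj L) hw a = 1) : 1 < Valued.v a := by
  haveI : Algebra.IsQuadraticExtension ↥(maximalRealSubfield L) L := IsCMField.isQuadraticExtension L
  exact one_lt_valued_of_traceOne_of_ramified_dyadic L v w hw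
    (fun h1 => hunr (isUnramifiedIn_of_ramificationIdx'_eq_one L (IsCMField.complexConj L) v (IsCMField.complexConj_ne_one L) w hw h1)) h2 ha

/-- **The minimal trace-one element IS integral off the wild corner, I: `|2|_w = 1`** (`2⁻¹` has trace one, ★ p862372 `exists_traceOne_of_v_two_eq_one`).
[cite: Serre1979, Ch. III §3] -/
theorem valued_traceMin_le_one_of_valued_two_eq_one (h2 : Valued.v (2 : w.1.adicCompletion L) = 1) {t : w.1.adicCompletion L}
    (htmin : ∀ a : w.1.adicCompletion L, a + galAdicCompletionMap (L := L) (IsCMField.complexConj L) hw a = 1 → Valued.v t ≤ Valued.v a) :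
    Valued.v t ≤ 1 := by
  obtain ⟨a, ha, hva⟩ := K2E3LevelNDepthWitnessTraceOne.exists_traceOne_of_v_two_eq_one (galAdicCompletionMap (L := L) (IsCMField.complexConj L) hw) h2
  exact (htmin a ha).trans hva

/-- **The minimal trace-one element IS integral off the wild corner, II: `v` unramified in `L`** (dyadic included: `Tr(𝒪_w) = 𝒪_v`, ★
`Rogawski1990.exists_valued_galAdicCompletionMap_sub_eq_one` + ★ p862372 `exists_traceOne_of_v_sub_conj_eq_one`, as ★ p862457 §2). [cite: Serre1979, Ch. V §2 Prop. 3, Ch. III §3] -/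
theorem valued_traceMin_le_one_of_isUnramifiedIn (hunr : Algebra.IsUnramifiedIn (𝓞 L) v.asIdeal) {t : w.1.adicCompletion L}
    (htmin : ∀ a : w.1.adicCompletion L, a + galAdicCompletionMap (L := L) (IsCMField.complexConj L) hw a = 1 → Valued.v t ≤ Valued.v a) :
    Valued.v t ≤ 1 := by
  obtain ⟨a₀, ha₀, hσa₀⟩ := Literature.NumberTheory.Rogawski1990.exists_valued_galAdicCompletionMap_sub_eq_one L v w hw hunr
  have hσσ := galAdicCompletionMap_galAdicCompletionMap_of_smul_eq (IsCMField.complexConj L) w (IsCMField.complexConj_ne_one L) hw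
  rw [Valuation.map_sub_swap] at hσa₀
  obtain ⟨a, ha, hva⟩ :=
    K2E3LevelNDepthWitnessTraceOne.exists_traceOne_of_v_sub_conj_eq_one (galAdicCompletionMap (L := L) (IsCMField.complexConj L) hw) hσσ ha₀ hσa₀
  exact (htmin a ha).trans hva

/-- **THE DICHOTOMY FOR THE MINIMAL TRACE-ONE ELEMENT at a place `w ∣ v` fixed by `c`**: its valuation is `= 1` if `v` is unramified in `L` or `|2|_w = 1`, and `> 1`
otherwise (the wildly ramified dyadic corner) — the two halves above.  [cite: Serre1979, Ch. III §3 Prop. 7, Ch. IV §1 Prop. 4, Ch. V §2 Prop. 3] [cite: Tits1979, §1.15] -/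
theorem valued_traceMin_eq_one_iff_not_wild {t : w.1.adicCompletion L}
    (ht : t + galAdicCompletionMap (L := L) (IsCMField.complexConj L) hw t = 1)
    (htmin : ∀ a : w.1.adicCompletion L, a + galAdicCompletionMap (L := L) (IsCMField.complexConj L) hw a = 1 → Valued.v t ≤ Valued.v a) :
    Valued.v t = 1 ↔ (Algebra.IsUnramifiedIn (𝓞 L) v.asIdeal ∨ Valued.v (2 : w.1.adicCompletion L) = 1) := by
  refine ⟨fun h1 => ?_, fun h => le_antisymm ?_ (one_le_valued_of_traceOne_adic L v w hw ht)⟩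
  · by_contra hnot
    rw [not_or] at hnot
    exact (lt_irrefl (1 : ℤᵐ⁰)) (h1 ▸ one_lt_valued_of_traceOne_of_not_isUnramifiedIn L v w hw hnot.1 hnot.2 ht)
  · rcases h with hunr | h2
    · exact valued_traceMin_le_one_of_isUnramifiedIn L v w hw hunr htmin
    · exact valued_traceMin_le_one_of_valued_two_eq_one L v w hw h2 htmin

end Adic

/-! ## §3 The PLACE-FREE `LocalRing L v = Π_{w ∣ v} L_w` form at a non-split `v` (the spelling a frame-free socket carries; ★ p862457 §1 transport) -/

section Local

variable (L : Type) [Field L] [NumberField L] [IsCMField L] (v : HeightOneSpectrum (𝓞 ↥(maximalRealSubfield L)))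

/-- **(W-0) PLACE-FREE: at a non-split `v` there is `t ∈ L ⊗ L⁺_v` with `t + (c ⊗ 1) t = 1` minimal at every place above `v`** — `w` is the only place above `v` (★
`PlacesOver.eq_of_smul_eq`), `((c ⊗ 1) a)_w = σ_w (a_w)` (★ `conjLocal_apply_eq_of_smul_eq`), and §2 at `w`.  The wild twin of ★ p862457's integral letter
`∃ t, t + conjLocal … t = 1 ∧ ∀ w′, |t_{w′}| ≤ 1` (which fails exactly at the wildly ramified dyadic places, §2). [cite: Serre1979, Ch. III §3 Prop. 7]
[cite: CasselsFrohlichANT1967, Ch. VII §1.1, Prop. 1.2] [cite: Tits1979, §1.15] -/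
theorem exists_traceOne_min_local (hns : ∀ w' : PlacesOver L v, IsCMField.complexConj L • w'.1 = w'.1) :
    ∃ t : LocalRing L v, t + conjLocal L (IsCMField.complexConj L) v t = 1 ∧
      ∀ a : LocalRing L v, a + conjLocal L (IsCMField.complexConj L) v a = 1 → ∀ w' : PlacesOver L v, Valued.v (t w') ≤ Valued.v (a w') := by
  classical
  obtain ⟨w⟩ := (inferInstance : Nonempty (PlacesOver L v))
  have hw : IsCMField.complexConj L • w.1 = w.1 := hns w
  obtain ⟨t₀, ht₀, hmin₀⟩ := exists_traceOne_min_adic L v w hw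
  refine ⟨Function.update 0 w t₀, ?_, fun a ha w' => ?_⟩
  · funext w'
    obtain rfl := (PlacesOver.eq_of_smul_eq (IsCMField.complexConj L) (IsCMField.complexConj_ne_one L) w hw w').symm
    rw [Pi.add_apply, Pi.one_apply, conjLocal_apply_eq_of_smul_eq (IsCMField.complexConj L) (IsCMField.complexConj_ne_one L) v w hw,
      Function.update_self]
    exact ht₀
  · obtain rfl := (PlacesOver.eq_of_smul_eq (IsCMField.complexConj L) (IsCMField.complexConj_ne_one L) w hw w').symm
    rw [Function.update_self]
    refine hmin₀ (a w) ?_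
    have h := congrFun ha w
    rwa [Pi.add_apply, Pi.one_apply, conjLocal_apply_eq_of_smul_eq (IsCMField.complexConj L) (IsCMField.complexConj_ne_one L) v w hw] at h

/-- **At a non-split `v`, the place-free trace-one relation read at a place**: `a + (c ⊗ 1) a = 1 ⟹ a_w + σ_w a_w = 1`, hence `1 ≤ |a_w|` (§2).
[cite: CasselsFrohlichANT1967, Ch. VII §1.1] [cite: Serre1979, Ch. III §3 Prop. 7] -/
theorem one_le_valued_apply_of_traceOne_local (w : PlacesOver L v) (hw : IsCMField.complexConj L • w.1 = w.1) {a : LocalRing L v}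
    (ha : a + conjLocal L (IsCMField.complexConj L) v a = 1) : 1 ≤ Valued.v (a w) := by
  refine one_le_valued_of_traceOne_adic L v w hw ?_
  have h := congrFun ha w
  rwa [Pi.add_apply, Pi.one_apply, conjLocal_apply_eq_of_smul_eq (IsCMField.complexConj L) (IsCMField.complexConj_ne_one L) v w hw] at h

end Local

end Summit.HodgeConjecture.HodgeConjecture.R90.S1

end
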